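import Literature.NumberTheory.GaloisRepresentations.ContinuousCohomologyFiniteProducts
import Mathlib.Data.Matrix.Mul
import HarnessLib

/-!
# Untwisting a matrix twist through the coinduced module: `Maps(Δ, A ⊗ M′) ≅ Maps(Δ, A) ⊗ M′`
# in coordinates (Milne ADT I Lemma 5.4; Serre, *Corps locaux* VII §5)

Topic `NumberTheory/GaloisRepresentations` (continuous cochain cohomology); namespace
`Literature.NumberTheory.GaloisRepresentations` (dot notation under `ContinuousRep`).  Definitions
with bodies and theorems; no named fact, no `sorry`, no instance, no notation.

Let `G` be a compact group, `W ⊴ G` open normal, `Δ = G ⧸ W`, `ρ` a continuous representation of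
`G` on a discrete `A`, and `a : Δ → Matrix (Fin d) (Fin d) ℤ` a "matrix representation of `Δ` on
`A`-valued vectors" (`a 1` acts as `1`, `a (c c′)` as `a c ∘ a c′` — hypotheses on the induced maps
`matAct`, so that only the action on `A` matters, e.g. matrices of an `𝔽_p[Δ]`-module `M′` in a
basis when `pA = 0`), with a two-sided inverse family `b`.  In coordinates `A ⊗ M′ = (Fin d → A)`
with the TWISTED diagonal action `(g x) i = Σ_j a(ḡ) i j • ρ g (x j)` (`ρ.piTwist W a …`).  Then:

* §1 `matAct` (matrix action on module-valued vectors) and `ρ.piTwist`;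
* §2 **`untwistEquiv : Maps(Δ, Fin d → A)_{twisted} ≃+ (Fin d → Maps(Δ, A))`**,
  `φ ↦ (i ↦ y ↦ (b(y) φ(y)) i)`: it intertwines the coinduced action of the twist
  (`(ρ.piTwist …).coindOpen W hW`) with the componentwise coinduced action
  (`(ρ.coindOpen W hW).piConst (Fin d)`, `ContinuousCohomologyFiniteProducts`) — `untwistEquiv_rep` —
  and carries the right translation `R_c` to the MATRIX endomorphism `(a(c) i j • R_c)ᵢⱼ`
  (`untwistEquiv_rTrans`; Milne I Lemma 5.4 (b) "`ψ ⊗ m ↦ ψ ⊗ ψ m`");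
* §3 on cohomology (`Hⁿ(c • f) = c • Hⁿ(f)`, `cohomologyMap_apply_of_smul`):
  **`Hⁿ(G, Maps(Δ, A ⊗ M′)) ≃+ (Fin d → Hⁿ(G, Maps(Δ, A)))`** carrying the right `Δ`-action
  `coindOpenHRep` of the twist to `h ↦ (Σ_j a(c) i j • (c • h j))ᵢ` (`untwist_coindOpenHRep`) — i.e.
  `𝓗ⁿ(A ⊗ M′) ≅ 𝓗ⁿ(A) ⊗ M′` as `Δ`-modules, in coordinates (Milne I Lemma 5.4 (a)).

Lane «TATE-EPC-TC» (cell `bsd-eis`, stmt-BirchSwinnertonDyer-19032), brick B8-alg (U): with B5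
(`descentEquiv`) it turns `#Hⁿ(U, M)` for a `W`-trivial `M = μ_p ⊗ M′` into the number of
`Δ`-invariants of `𝓗ⁿ(μ_p) ⊗ M′`.  HONEST FRAMING: module bookkeeping only; no arithmetic statement and
no case of BSD is proved here.

## References
* J. S. Milne, *Arithmetic Duality Theorems*, 2nd ed. (2006), I Lemma 5.4 (a), (b). [MilneADT2006]
* J.-P. Serre, *Corps locaux* / *Local Fields* (1979), VII §5. [SerreLocalFields1979]
-/

noncomputable section

open CategoryTheory Function
open scoped Topology

universe u w

namespace Literature.NumberTheory.GaloisRepresentations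

open _root_.TopRep _root_.ContRepresentation _root_.ContinuousCohomology

/-! ## §0 `Hⁿ(c • f) = c • Hⁿ(f)` -/

section Smul

variable {k : Type w} [CommRing k] [TopologicalSpace k]
variable {G : Type u} [Group G] [TopologicalSpace G] [IsTopologicalGroup G]
variable {X Y : TopRep.{u} k G}

/-- **If `h = c • f` pointwise then `Hⁿ(h) = c • Hⁿ(f)`** (homogeneous cochains).
[cite: MilneADT2006, I Lemma 5.4 (a)] -/
theorem cohomologyMap_apply_of_smul (f h : X ⟶ Y) (c : k) (hh : ∀ v : X, h.hom v = c • f.hom v)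
    (n : ℕ) (x : continuousCohomology n X) : cohomologyMap h n x = c • cohomologyMap f n x := by
  have hres : ∀ (m : ℕ) (v : resolutionX X m), (resolutionHom h m).hom v = c • (resolutionHom f m).hom v := by
    intro m
    induction m with
    | zero => intro v; exact hh v
    | succ m ih =>
      intro Φ
      ext y
      rw [resolutionHom_succ_hom_apply, ih, ContinuousMap.coe_smul, Pi.smul_apply,
        resolutionHom_succ_hom_apply]
  have hcoch : ∀ (i : ℕ) (σ : (homogeneousCochains X).X i),
      (cochainsHom h).f i σ = c • (cochainsHom f).f i σ := fun i σ =>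
    Subtype.ext (by rw [cochainsHom_f_coe, hres]; rfl)
  obtain ⟨σ, hσ, rfl⟩ := cxClass_surjective (homogeneousCochains X) n (n + 1) (up_nat_next n) x
  have hσf : (homogeneousCochains Y).d n (n + 1) ((cochainsHom f).f n σ) = 0 := by
    rw [hom_f_d_apply, hσ, map_zero]
  have hσc : (homogeneousCochains Y).d n (n + 1) (c • (cochainsHom f).f n σ) = 0 := by
    rw [map_smul, hσf, smul_zero]
  change HomologicalComplex.homologyMap (cochainsHom h) n _ = c • HomologicalComplex.homologyMap (cochainsHom f) n _
  rw [homologyMap_cxClass (cochainsHom h) n (n + 1) (up_nat_next n) σ hσ _ hσc (hcoch n σ).symm,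
    homologyMap_cxClass (cochainsHom f) n (n + 1) (up_nat_next n) σ hσ _ hσf rfl, cxClass_smul]

end Smul

namespace ContinuousRep

/-! ## §1 Matrix action on `A`-valued vectors and the twisted representation -/

section MatAct

variable {A : Type u} [AddCommGroup A] {d : ℕ}

/-- **`(m x) i = Σ_j m i j • x j`**: an integer matrix acting on `A`-valued vectors.
[cite: MilneADT2006, I Lemma 5.4 (b)] -/
def matAct (m : Matrix (Fin d) (Fin d) ℤ) (x : Fin d → A) : Fin d → A := fun i => ∑ j, m i j • x j

/-- Formula. [cite: MilneADT2006, I Lemma 5.4 (b)] -/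
@[simp] theorem matAct_apply (m : Matrix (Fin d) (Fin d) ℤ) (x : Fin d → A) (i : Fin d) :
    matAct m x i = ∑ j, m i j • x j := rfl

/-- `matAct m` is additive. [cite: MilneADT2006, I Lemma 5.4 (b)] -/
theorem matAct_add (m : Matrix (Fin d) (Fin d) ℤ) (x y : Fin d → A) :
    matAct m (x + y) = matAct m x + matAct m y := by
  funext i; simp only [matAct_apply, Pi.add_apply, smul_add, Finset.sum_add_distrib]

/-- `matAct m` commutes with integer scalars. [cite: MilneADT2006, I Lemma 5.4 (b)] -/
theorem matAct_zsmul (m : Matrix (Fin d) (Fin d) ℤ) (n : ℤ) (x : Fin d → A) :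
    matAct m (n • x) = n • matAct m x := by
  funext i; simp only [matAct_apply, Pi.smul_apply, smul_comm (m i _) n, Finset.smul_sum]

/-- `matAct m` commutes with coordinatewise additive maps. [cite: MilneADT2006, I Lemma 5.4 (b)] -/
theorem map_matAct {B : Type*} [AddCommGroup B] (f : A →+ B) (m : Matrix (Fin d) (Fin d) ℤ)
    (x : Fin d → A) (i : Fin d) : f (matAct m x i) = matAct m (fun j => f (x j)) i := by
  simp only [matAct_apply, map_sum, map_zsmul]

end MatAct

section Twist

variable {G : Type u} [Group G] [TopologicalSpace G] [IsTopologicalGroup G] [CompactSpace G]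
variable {A : Type u} [AddCommGroup A] [TopologicalSpace A] [DiscreteTopology A]
variable (ρ : ContinuousRep G ℤ A) (W : Subgroup G) [W.Normal] (hW : IsOpen (W : Set G)) {d : ℕ}
  (a b : G ⧸ W → Matrix (Fin d) (Fin d) ℤ)
  (ha1 : ∀ x : Fin d → A, matAct (a 1) x = x)
  (hamul : ∀ (c c' : G ⧸ W) (x : Fin d → A), matAct (a (c * c')) x = matAct (a c) (matAct (a c') x))
  (hab : ∀ (c : G ⧸ W) (x : Fin d → A), matAct (a c) (matAct (b c) x) = x)
  (hba : ∀ (c : G ⧸ W) (x : Fin d → A), matAct (b c) (matAct (a c) x) = x)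

omit [IsTopologicalGroup G] [CompactSpace G] [DiscreteTopology A] in
/-- `ρ g` (coordinatewise) commutes with `matAct`. [cite: MilneADT2006, I Lemma 5.4 (b)] -/
theorem rho_matAct (g : G) (m : Matrix (Fin d) (Fin d) ℤ) (x : Fin d → A) :
    (fun i => ρ g (matAct m x i)) = matAct m (fun j => ρ g (x j)) :=
  funext fun i => map_matAct (ρ g).toAddMonoidHom m x i

include ha1 hamul hW in
/-- **The twisted diagonal representation on `Fin d → A`**, `(g x) i = Σ_j a(ḡ) i j • ρ g (x j)`
(= `A ⊗ M′` in a basis of the `W`-trivial `M′` with matrices `a`).  Continuity: the stabiliser of `x`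
contains `W ∩ ⋂_j Stab(x j)`. [cite: MilneADT2006, I Lemma 5.4 (b)] [cite: SerreLocalFields1979, VII §5] -/
def piTwist : ContinuousRep G ℤ (Fin d → A) :=
  ContinuousRep.ofStabilizerMemNhdsOne
    { toFun := fun g =>
        { toFun := fun x => matAct (a (g : G ⧸ W)) (fun j => ρ g (x j))
          map_add' := fun x y => by
            rw [← matAct_add]; congr 1; funext j; exact map_add _ _ _
          map_smul' := fun n x => by
            rw [RingHom.id_apply, ← matAct_zsmul]; congr 1; funext j; exact map_zsmul _ _ _ }
      map_one' := LinearMap.ext fun x => by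
        change matAct (a ((1 : G) : G ⧸ W)) (fun j => ρ 1 (x j)) = x
        rw [QuotientGroup.mk_one, map_one]
        exact ha1 x
      map_mul' := fun g h => LinearMap.ext fun x => by
        change matAct (a ((g * h : G) : G ⧸ W)) (fun j => ρ (g * h) (x j)) =
          matAct (a (g : G ⧸ W)) (fun j => ρ g (matAct (a (h : G ⧸ W)) (fun k => ρ h (x k)) j))
        rw [QuotientGroup.mk_mul, hamul, rho_matAct]
        simp only [map_mul, Module.End.mul_apply] }
    fun x => by
      have hval : ∀ j : Fin d, ∀ᶠ g in 𝓝 (1 : G), ρ g (x j) = x j := fun j =>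
        ρ.setOf_apply_eq_mem_nhds_one (x j)
      filter_upwards [hW.mem_nhds W.one_mem, Filter.eventually_all.2 hval] with g hg hg'
      change matAct (a (g : G ⧸ W)) (fun j => ρ g (x j)) = x
      rw [(QuotientGroup.eq_one_iff g).2 hg]
      simp only [hg']
      exact ha1 x

omit [CompactSpace G] in
/-- Formula: `(piTwist g x) i = Σ_j a(ḡ) i j • ρ g (x j)`. [cite: MilneADT2006, I Lemma 5.4 (b)] -/
@[simp] theorem piTwist_apply (g : G) (x : Fin d → A) :
    ρ.piTwist W hW a ha1 hamul g x = matAct (a (g : G ⧸ W)) (fun j => ρ g (x j)) := rfl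

/-! ## §2 The untwisting isomorphism -/

/-- **Untwisting**: `φ ↦ (i ↦ y ↦ (b(y) φ(y)) i)`, `Maps(Δ, Fin d → A) → (Fin d → Maps(Δ, A))`, with
inverse `ψ ↦ (y ↦ a(y) (j ↦ ψ j y))`. [cite: MilneADT2006, I Lemma 5.4 (b)] -/
def untwistEquiv : (G ⧸ W → Fin d → A) ≃+ (Fin d → G ⧸ W → A) where
  toFun φ i y := matAct (b y) (φ y) i
  invFun ψ y := matAct (a y) (fun j => ψ j y)
  left_inv φ := funext fun y => hab y (φ y)
  right_inv ψ := by
    funext i y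
    exact congr_fun (hba y (fun j => ψ j y)) i
  map_add' φ φ' := by
    funext i y
    change matAct (b y) (φ y + φ' y) i = matAct (b y) (φ y) i + matAct (b y) (φ' y) i
    rw [matAct_add, Pi.add_apply]

omit [TopologicalSpace G] [IsTopologicalGroup G] [CompactSpace G] [TopologicalSpace A]
  [DiscreteTopology A] [W.Normal] in
/-- Formula. [cite: MilneADT2006, I Lemma 5.4 (b)] -/
@[simp] theorem untwistEquiv_apply (φ : G ⧸ W → Fin d → A) (i : Fin d) (y : G ⧸ W) :
    untwistEquiv W a b hab hba φ i y = matAct (b y) (φ y) i := rfl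

omit [TopologicalSpace G] [IsTopologicalGroup G] [CompactSpace G] [TopologicalSpace A]
  [DiscreteTopology A] [W.Normal] in
/-- Formula for the inverse. [cite: MilneADT2006, I Lemma 5.4 (b)] -/
@[simp] theorem untwistEquiv_symm_apply (ψ : Fin d → G ⧸ W → A) (y : G ⧸ W) :
    (untwistEquiv W a b hab hba).symm ψ y = matAct (a y) (fun j => ψ j y) := rfl

omit [TopologicalSpace G] [IsTopologicalGroup G] [CompactSpace G] [TopologicalSpace A]
  [DiscreteTopology A] in
include hamul hab hba in
/-- The key identity `b(y) a(c̄) = b(c̄⁻¹ y)` on `A`-valued vectors. [cite: MilneADT2006, I Lemma 5.4 (b)] -/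
theorem matAct_b_a (c y : G ⧸ W) (x : Fin d → A) :
    matAct (b y) (matAct (a c) x) = matAct (b (c⁻¹ * y)) x := by
  conv_lhs => rw [← hab (c⁻¹ * y) x, ← hamul, mul_inv_cancel_left, hba]

/-- Unfolding the coinduced action of the twist: `(g ⋆ φ)(y) = a(ḡ) (ρ g ∘ φ(g⁻¹ y))`.
[cite: MilneADT2006, I Lemma 5.4 (b)] -/
theorem piTwist_coindOpen_apply (g : G) (φ : G ⧸ W → Fin d → A) (y : G ⧸ W) :
    ((ρ.piTwist W hW a ha1 hamul).coindOpen W hW g φ) y =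
      matAct (a (g : G ⧸ W)) (fun j => ρ g (φ (g⁻¹ • y) j)) := rfl

omit [TopologicalSpace G] [IsTopologicalGroup G] [CompactSpace G] in
/-- In `G ⧸ W`: `g • y = ḡ * y`. [cite: SerreLocalFields1979, VII §5] -/
theorem smul_quotient_eq_mk_mul (g : G) (y : G ⧸ W) : g • y = (g : G ⧸ W) * y := by
  induction y using QuotientGroup.induction_on with
  | H x => rw [MulAction.Quotient.smul_coe, smul_eq_mul, QuotientGroup.mk_mul]

include hamul hab hba in
/-- **`G`-equivariance of the untwisting**: it carries the coinduced action of the twist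
(`(ρ.piTwist …).coindOpen W hW`) to the componentwise coinduced action
(`(ρ.coindOpen W hW).piConst (Fin d)`). [cite: MilneADT2006, I Lemma 5.4 (b)] [cite: SerreLocalFields1979, VII §5] -/
theorem untwistEquiv_rep (g : G) (φ : G ⧸ W → Fin d → A) :
    untwistEquiv W a b hab hba ((ρ.piTwist W hW a ha1 hamul).coindOpen W hW g φ) =
      (ρ.coindOpen W hW).piConst (Fin d) g (untwistEquiv W a b hab hba φ) := by
  funext i y
  rw [untwistEquiv_apply, piTwist_coindOpen_apply, matAct_b_a W a b hamul hab hba, piConst_apply,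
    coindOpen_apply_apply, untwistEquiv_apply, smul_quotient_eq_mk_mul, QuotientGroup.mk_inv]
  exact (congr_fun (ρ.rho_matAct g (b ((g : G ⧸ W)⁻¹ * y)) (φ ((g : G ⧸ W)⁻¹ * y))) i).symm

/-- The integer multiple `n • R_c` of the right translation, as a morphism. [cite: SerreLocalFields1979, VII §5] -/
def zsmulRTrans (n : ℤ) (c : G ⧸ W) : (ρ.coindOpen W hW).toTopRep ⟶ (ρ.coindOpen W hW).toTopRep :=
  TopRep.ofHom
    { toLinearMap := n • (ρ.coindOpenRTrans W hW c).hom.toLinearMap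
      cont := by
        haveI : DiscreteTopology (G ⧸ W → A) := discreteTopology_coindOpen W hW
        exact continuous_of_discreteTopology
      isIntertwining' := fun g => by
        have key : ∀ φ : G ⧸ W → A, n • (ρ.coindOpenRTrans W hW c).hom (ρ.coindOpen W hW g φ) =
            ρ.coindOpen W hW g (n • (ρ.coindOpenRTrans W hW c).hom φ) := fun φ => by
          rw [map_zsmul, ← ContinuousRep.hom_comm_apply (ρ.coindOpenRTrans W hW c) g φ]
        ext φ y
        exact congr_fun (key φ) y }

/-- Formula: `zsmulRTrans n c φ = n • R_c φ`. [cite: SerreLocalFields1979, VII §5] -/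
@[simp] theorem zsmulRTrans_apply (n : ℤ) (c : G ⧸ W) (φ : G ⧸ W → A) :
    (ρ.zsmulRTrans W hW n c).hom φ = n • (ρ.coindOpenRTrans W hW c).hom φ := rfl

include hamul hab hba in
/-- **The untwisting carries `R_c` to the matrix endomorphism `(a(c) i j • R_c)ᵢⱼ`.**
[cite: MilneADT2006, I Lemma 5.4 (b)] -/
theorem untwistEquiv_rTrans [Fintype (G ⧸ W)] (c : G ⧸ W) (φ : G ⧸ W → Fin d → A) :
    untwistEquiv W a b hab hba (((ρ.piTwist W hW a ha1 hamul).coindOpenRTrans W hW c).hom φ) =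
      ((ρ.coindOpen W hW).piMatrix (ρ.coindOpen W hW) (Fin d) (Fin d)
        (fun i j => ρ.zsmulRTrans W hW (a c i j) c)).hom (untwistEquiv W a b hab hba φ) := by
  funext i y
  have key : matAct (b y) (φ (y * c)) = matAct (a c) (fun j => matAct (b (y * c)) (φ (y * c)) j) := by
    conv_lhs => rw [← hab (y * c) (φ (y * c)), hamul, hba]
  change matAct (b y) (φ (y * c)) i =
    (∑ j, (ρ.zsmulRTrans W hW (a c i j) c).hom (untwistEquiv W a b hab hba φ j)) y
  rw [key, Finset.sum_apply]
  rfl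

/-! ## §3 On cohomology -/

include hamul hab hba in
/-- **`Hⁿ(G, Maps(Δ, A ⊗ M′)) ≃+ (Fin d → Hⁿ(G, Maps(Δ, A)))`** (untwisting + finite products), the
coordinates of `𝓗ⁿ(A) ⊗ M′`. [cite: MilneADT2006, I Lemma 5.4 (a)] -/
theorem nonempty_untwist_cohomology_addEquiv [Fintype (G ⧸ W)] (n : ℕ) :
    ∃ e : (continuousCohomology n ((ρ.piTwist W hW a ha1 hamul).coindOpen W hW).toTopRep : Type u) ≃+
        (Fin d → (continuousCohomology n (ρ.coindOpen W hW).toTopRep : Type u)),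
      ∀ (c : G ⧸ W) (x : continuousCohomology n ((ρ.piTwist W hW a ha1 hamul).coindOpen W hW).toTopRep)
        (i : Fin d),
        e ((ρ.piTwist W hW a ha1 hamul).coindOpenHRep W hW n c x) i =
          ∑ j, a c i j • ρ.coindOpenHRep W hW n c (e x j) := by
  haveI : DiscreteTopology (G ⧸ W → Fin d → A) := discreteTopology_coindOpen W hW
  haveI : DiscreteTopology (G ⧸ W → A) := discreteTopology_coindOpen W hW
  let η : (G ⧸ W → Fin d → A) ≃ₜ+ (Fin d → G ⧸ W → A) :=
    { untwistEquiv W a b hab hba with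
      continuous_toFun := continuous_of_discreteTopology
      continuous_invFun := continuous_of_discreteTopology }
  let e₁ := continuousCohomologyAddEquiv
    (X := ((ρ.piTwist W hW a ha1 hamul).coindOpen W hW).toTopRep)
    (Y := ((ρ.coindOpen W hW).piConst (Fin d)).toTopRep) η
    (fun g φ => untwistEquiv_rep ρ W hW a b ha1 hamul hab hba g φ) n
  refine ⟨e₁.trans ((ρ.coindOpen W hW).piCohomologyEquiv (Fin d) n), fun c x i => ?_⟩
  -- transport `Hⁿ(R_c)` along `η`: `η ∘ R_c = T_c ∘ η`
  have hsq : ∀ φ, η (((ρ.piTwist W hW a ha1 hamul).coindOpenRTrans W hW c).hom φ) =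
      ((ρ.coindOpen W hW).piMatrix (ρ.coindOpen W hW) (Fin d) (Fin d)
        (fun i j => ρ.zsmulRTrans W hW (a c i j) c)).hom (η φ) := fun φ =>
    untwistEquiv_rTrans ρ W hW a b ha1 hamul hab hba c φ
  have hnat : e₁ (cohomologyMap ((ρ.piTwist W hW a ha1 hamul).coindOpenRTrans W hW c) n x) =
      cohomologyMap ((ρ.coindOpen W hW).piMatrix (ρ.coindOpen W hW) (Fin d) (Fin d)
        (fun i j => ρ.zsmulRTrans W hW (a c i j) c)) n (e₁ x) :=
    continuousCohomologyAddEquiv_map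
      (X := ((ρ.piTwist W hW a ha1 hamul).coindOpen W hW).toTopRep)
      (X' := ((ρ.coindOpen W hW).piConst (Fin d)).toTopRep)
      (Y := ((ρ.piTwist W hW a ha1 hamul).coindOpen W hW).toTopRep)
      (Y' := ((ρ.coindOpen W hW).piConst (Fin d)).toTopRep)
      η (fun g φ => untwistEquiv_rep ρ W hW a b ha1 hamul hab hba g φ)
      η (fun g φ => untwistEquiv_rep ρ W hW a b ha1 hamul hab hba g φ) (ContinuousMonoidHom.id G)
      (resIdHom ((ρ.piTwist W hW a ha1 hamul).coindOpenRTrans W hW c))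
      (resIdHom ((ρ.coindOpen W hW).piMatrix (ρ.coindOpen W hW) (Fin d) (Fin d)
        (fun i j => ρ.zsmulRTrans W hW (a c i j) c))) hsq n x
  rw [AddEquiv.trans_apply, coindOpenHRep_apply', hnat, piCohomologyEquiv_matrix]
  refine Finset.sum_congr rfl fun j _ => ?_
  rw [AddEquiv.trans_apply, coindOpenHRep_apply']
  rw [cohomologyMap_apply_of_smul (ρ.coindOpenRTrans W hW c) (ρ.zsmulRTrans W hW (a c i j) c)
    (a c i j) (fun φ => rfl) n]
  exact int_smul_eq_zsmul _ _ _

end Twist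

end ContinuousRep

end Literature.NumberTheory.GaloisRepresentations

end
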